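import Literature.MathematicalPhysics.QuantumFieldTheory.Balaban1983to89.B8Thm4ConcreteLanEGammaPer
import Literature.MathematicalPhysics.QuantumFieldTheory.Balaban1983to89.B8Thm4CoreZdGF3HPLanEGamma
import Literature.MathematicalPhysics.QuantumFieldTheory.Balaban1983to89.B8LeafModelZdHP2Per

/-!
# `Balaban1983to89.B8Thm4CoreZdGF3HP2PerLanEGamma` — [Balaban1985RegularSpaces] Thm 4 p. 88 ∕ Thm 8 (1.146) p. 101: the Theorem-4-shaped CORE ON THE
# `P`-PERIODIC SUB-MODEL `B8LeafModelZdHP2Per.zdGF3HP₂Per` OF THE REPAIRED MEMBER OF RECORD, WITH PERIODICITY-GUARDED SOCKETS — brick T5 (member layer) of the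
# package «N05-(β′)-GT»: dag-n05-d's `B8Thm4CoreZdGF3HPLanEGamma.thm4Core_zdGF3HP_map_lanE_γ'` re-keyed on dag-n05-w1's periodic body
# `B8Thm4ConcreteLanEGammaPer.thm4Body_concrete_uniform_lanE_γ'_per` (the honest `GT_per` witness: periodic BY CONSTRUCTION, no «uniqueness ⇒ periodicity» device)

statement-level skeleton of published theorems with citation tags; proofs where landed; nothing here is a claim about the Yang–Mills mass gap

T. Bałaban, *Spaces of regular gauge field configurations on a lattice and gauge fixing conditions*, Commun. Math. Phys. **99** (1985) 75–102
`[Balaban1985RegularSpaces]` ("B8"): Thm 4 p. 88 (proof pp. 88–89 ∕ 94–95), (1.29) p. 81, (1.31) p. 82, (1.35) p. 82, (1.37)–(1.38) p. 82, (1.62) p. 87, (1.65)–(1.66)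
pp. 87–88, Prop. 5 (1.107)–(1.109) p. 94, Thm 8 (1.146) p. 101, p. 77 («Ω₀ ⊃ Ω₁ ⊃ … we admit the case when some domains Ω_j are equal to T_η»; (1.5)–(1.6) towers).
`[Balaban1985BackgroundPropagators]` ("[4]") Thm 3.3 p. 398.  `[Balaban1985Averaging]` (4) p. 18 (the torus `T_η` as `P`-periodic data on `ηℤᵈ`).
PDF held: `paper:balaban1985-cmp99-regular-spaces-gauge-fixing` (journal page = PDF page + 74).

CITATION HEADER (lean-in-tree rule).  Cell `pub-ymgap` (HUMAN RULING D-0062, Track A), DAG node N05 = [B8], seat `pub-ymgap-dag-n05-c` (g17; the member-model ∕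
transfer lineage: P1 `B8LeafModelZdPer`, P1′ `B8LeafModelZdHP2Per`, `B8LeafModelZdPerTransfer`, `B8LeafModelZdHP2PerTransfer`); plan g87 word
«YMPLAN-G87-N05GT-T5-DRAFT — GO DRAFT, n05-c's» (pub-ymgap bus 2026-08-28T16:14:40Z).

WHY THIS FILE.  On the (β′-PERIODIC) road of record (director-ym №217 ∕ №222 ∕ №223) the [B8] leaf is read on the periodic sub-model
`zdGF3HP₂Per 𝔸 L β len i P` (P1′).  Its Theorem-2∕4∕8 conjuncts are supplied today by the TRANSFERS `thm4∕thm2Printed_hp2per_of_zd` ∕ dag-n05-d's E8a knit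
from the `ℤᵈ` member theorems, whose Theorem-4-shaped core `thm4Core_zdGF3HP_map_lanE_γ'` displays the four member sockets `SP5base ∕ SP5 ∕ SH59src ∕ SP5u`
(Prop. 5 ∃ at levels 1 and m+1, [4] Thm 3.3 with source, Prop. 5 !) at ALL unitary pairs and ALL intermediate objects on `ℤᵈ` — «[4] ∕ Prop 5 in infinite volume
at periodic members», unsuppliable by torus objects (dag-n05-w1 LOCATED, bus l.40481).  dag-n05-w1's engine layer T1–T4b re-runs Theorem 4's induction with the
periodicity invariant THREADED: every socket is asked at PERIODIC data only and returns periodic objects (`thm4Body_concrete_uniform_lanE_γ'_per`).  THIS FILE is the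
MEMBER LAYER on top of it: the core AT THE PERIODIC MEMBER, sockets GUARDED, the produced gauge transformation an element of the member's periodic gauge group
`GT_per` because T4b SAYS it is periodic — not because a uniqueness clause forces it.

WHAT THIS FILE PROVES (two theorems, no `def`).
★★ `thm4Core_zdGF3HP₂Per_map_lanE_γ'` — `thm4Core_zdGF3HP_map_lanE_γ'`'s sentence over an index map `ι : J → ZdIdx d L` AND a period map `p : J → ℕ`, with:
member `zdGF3HP₂Per 𝔸 L β len (ι a) (p a)`; the four sockets = T4b's GUARDED texts member-ised at `ι a` (pair guard `IsPeriodic (p a) U₀ → IsPeriodic (p a) U′ →`,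
riders: `SP5base ∕ SP5` periodic level datum in ∕ `IsPeriodic (p a) v` out, `SH59src` periodic `(u, W, A′)`, `SP5u` periodic competitor and periodic `(v, w, λ, μ)`;
`SH59src`'s `|B₁|` over print's class `towerBondsP L (ι a).Ω ((ι a).Λs m) ·`) — these texts minus the guards ARE the `ℤᵈ` core's, token for token; TWO member
hypotheses — the tower law at every truncation (as in the `ℤᵈ` core) and `hΩp : ∀ j ≤ (ι a).k, IsPeriodic (p a) (· ∈ (ι a).Ω j)` (dag-n05-w2's `IdxB8SubDPer` law);
conclusion AT THE PERIODIC MEMBER: `∃ u : (zdGF3HP₂Per …).GT` with `Restricted`, (1.37) `C137 α₁` (print's class), `LanF a U₀ φ (ι a).k` for `U′^{u⁻¹}`, the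
(1.62)-shape `C162 (5dL·B₈) (α₀ + α₁)`, unique among the member's (periodic, restricted) competitors with the gauge condition and the (1.62)-shape.
★★ `thm4Core_zdGF3HP₂Per_lanE_γ'` — the single-family edition `∀ (i : ZdIdx d L) (P : ℕ)` (sockets indexed by `(i, P)`), from the map edition at `J := ZdIdx d L × ℕ`.
PROOF = dag-n05-d's, token for token: ONE threshold from `thm4Body_concrete_uniform_lanE_γ'_per` (constants only) `∧` the γ windows; at a member, `InAAx`'s first
conjunct pins `Q.1 = U₀` (`Subtype.ext`), T4b is called at the underlying fields with the carriers' periodicity (`U₀.2.2`, `Q.2.2.2`) and `hΩp`, (1.37) by dag-n05-w2's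
`B8Eq142KLevelLocalGammaPrime.H42_of_inAx_γ'` on the canonical masked exponent (`mlogCfg_spec`), the witness `⟨u, ⟨unitary, support⟩, periodic⟩ : GT_per`, uniqueness
= T4b's «unique among PERIODIC restricted competitors» read through the subtype (`u′.2.2`).

HONEST SCOPE.  Assembly BY NAME over dag-n05-w1's T4b; the four sockets are HYPOTHESES (now askable at periodic data: a torus Proposition 5 and a torus [4] Thm 3.3
can serve them); nothing of Theorem 4 ∕ 8's analysis is proved here; the knit layer (T6: t4 ∕ t2 ∕ t8 on this core) is dag-n05-d's and NOT here; count-neutral; N05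
NOT discharged; `≤` where print has `<`; `T_η` read as `P`-periodic data on `ηℤᵈ`; one finite `T⁴` programme at fixed `ε` — nothing continuum ∕ ℝ⁴ ∕ OS ∕
mass-gap ∕ Clay.  No `sorry`, no `def`, no `instance`, no `notation`.  Unit `pub-ymgap-dag-n05-c` (g17), 2026-08-28.
-/

noncomputable section

open NormedSpace

namespace Literature.MathematicalPhysics.QuantumFieldTheory.Balaban1983to89.B8Thm4CoreZdGF3HP2PerLanEGamma

open Complex (I)
open MatrixLog B7Prop1Explicit B7Prop2Explicit B7Prop1Local B7Eq92Concrete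
open B7Prop2Explicit (C0 c2' unitaryUnits unitaryUnits_le_U1)
open B8Ineq132 (covDerivFwd InAk BondTouches)
open B8Eq119TwistedAxial (Restr129 InAx)
open B8Eq184Proof (gaugeExp cfgExp)
open B8Lemma1NonAbelian (mulCfg)
open B8Eq140Level (SideTouches)
open B8Eq146AExpansion (iEta)
open B7Prop4GeneralLevels (logCovIter linCovIter)
open B8Eq155JBound (Jcur wsup)
open B8ScaledSupNorm (bondNorm msup)
open B8Thm2LogB (blockTop)
open B8Ineq130 (tlo thi)
open B8Eq138LandauZd (logCfg)
open B8Prop3GaugeFixedKLevel (mem_unitaryUnits_of_mgauge_eq)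
open B8Thm4AtLandau138 (mgauge_mgauge_inv)
open B8Thm4ConcreteLanEGammaPer (thm4Body_concrete_uniform_lanE_γ'_per)
open B8Thm4Windows (thm4_windows thm4_windows_extra)
open B8Thm4ExistsConcreteGamma (thm4_windows_γ)
open B8LeafModelZd (ZdIdx)
open B8LeafModelZd3 (zdGF3 mlogCfg mlogCfg_spec)
open B8LeafModelZd3P2 (zdGF3HP₂)
open B8LeafModelZdHP2Per (zdGF3HP₂Per)
open B8TowerBondsPrinted (towerBondsP)
open T4TermwiseTorus (IsPeriodic)

-- `Site` alone could resolve to the torus sites of `Setup.lean`; re-export the `ℤ^d` sites of `B7Prop1Explicit`.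
export B7Prop1Explicit (Site)

variable {d : ℕ}

section Core

variable {𝔸 : Type} [CStarAlgebra 𝔸] [Nontrivial 𝔸]

/-- ★★ **THEOREM 4 ∕ THEOREM 8, THE THEOREM-4-SHAPED CORE ON THE PERIODIC SUB-MODEL `zdGF3HP₂Per ∘ (ι, p)` OF THE REPAIRED MEMBER OF RECORD, OVER AN INDEX MAP
`ι : J → ZdIdx d L` AND A PERIOD MAP `p : J → ℕ`, PERIODICITY-GUARDED SOCKETS (EDITION γ′, SOURCE-INDEXED GAUGE PREDICATE, E-CURRENCY UNIQUENESS)** —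
dag-n05-d's `B8Thm4CoreZdGF3HPLanEGamma.thm4Core_zdGF3HP_map_lanE_γ'` with: the member `zdGF3HP₂Per 𝔸 L β len (ι a) (p a)` (`(p a)`-periodic unitary
configurations ∕ pairs ∕ gauge transformations — print's `T_η`, p. 77); the four sourced sockets demanded AT `ι a` and AT `(p a)`-PERIODIC ARGUMENTS ONLY —
`SP5base` ∕ `SP5` (Prop. 5 ∃ at `LanF a`, levels `1` and `m + 1`: periodic pair and periodic level datum `(u₁, U₁, A)` in, a periodic `v` out), `SH59src`
([4] Thm 3.3 + (1.57)–(1.58) with source, `+ γ′B₀(α₀ + α₁)`, `|B₁|` over print's class `towerBondsP L (ι a).Ω ((ι a).Λs m) ·`: periodic `(u, W, A′)`),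
`SP5u` (Prop. 5's uniqueness (1.109) at `LanF a`: periodic competitor `u₁`, periodic `(v, w, λ, μ)`) — dag-n05-w1's T4b texts member-ised, and minus the
guards EXACTLY the `ℤᵈ` core's socket texts; for `d, L ≥ 2`, the [4] constants `B₀, B₀′ > 0`, Prop. 5's radius `cu > 0`, the providers' threshold `cP > 0`,
source constants `γ′ ≥ 0` and `B₈ ≥ B₀` with `5dLB₀ + 2γ′B₀ ≤ 5dLB₈`, `2 ≤ 5dLB₈`, any Hölder data `β, len`: ONE threshold `c₁` (constants only) such
that at every `a : J` whose member supplies its tower law at every truncation ((1.5)–(1.6) p. 77) and whose domains `Ω_j`, `j ≤ k`, are `(p a)`-periodic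
(the periodic (1.5)-index's law), the member's (1.33) ∕ (1.34) ∕ (1.35)+(1.66)₀ at `(α₀, α₁)`, `α₀ + α₁ ≤ c₁`, and an admitted source `φ` give a gauge
transformation `u` OF THE PERIODIC MEMBER (unitary, `= 1` off `Ω₀`, `(p a)`-periodic), restricted ((1.29)), with (1.37) `C137 α₁` in print's class,
`LanF a U₀ φ (ι a).k` for `U′^{u⁻¹}`, the (1.62)-shape `C162 (5dL·B₈) (α₀ + α₁)`, UNIQUE among the member's restricted gauge transformations with the gauge
condition and the (1.62)-shape.  PROOF = the `ℤᵈ` core's token for token on `B8Thm4ConcreteLanEGammaPer.thm4Body_concrete_uniform_lanE_γ'_per` (module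
docstring); (1.37) by `B8Eq142KLevelLocalGammaPrime.H42_of_inAx_γ'` with the γ windows of `thm4_windows_γ`.
[cite: Balaban1985RegularSpaces, Thm 4 p.88, pp.88–89 + 94–95, Thm 8 (1.146) p.101, (1.29) p.81, (1.31) p.82, (1.35) p.82, (1.37)–(1.38) p.82, (1.62) p.87, (1.66) p.88, Prop. 5 (1.107)–(1.109) p.94, p.77 («Ω_j ⊂ T_η»); Balaban1985BackgroundPropagators, Thm 3.3 p.398; Balaban1985Averaging, (4) p.18] -/
theorem thm4Core_zdGF3HP₂Per_map_lanE_γ' (hd2 : 2 ≤ d) {L : ℕ} (hL : 2 ≤ L) {β : ℝ} {len : Site d → ℝ} {B₀ B₀' cu cP : ℝ} (hB₀ : 0 < B₀)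
    (hB₀' : 0 < B₀') (hcu : 0 < cu) (hcP : 0 < cP)
    {Φ : Type*} {γ' B₈ : ℝ} (hγ' : 0 ≤ γ') (hB₈ : 0 < B₈) (hB₀8 : B₀ ≤ B₈) (hB : 2 ≤ 5 * (d : ℝ) * L * B₈)
    (hγB : 5 * (d : ℝ) * L * B₀ + 2 * (γ' * B₀) ≤ 5 * (d : ℝ) * L * B₈)
    {J : Type} (ι : J → ZdIdx d L) (p : J → ℕ)
    (Adm : J → Φ → (Site d → Fin d → 𝔸ˣ) → ℝ → ℝ → Prop)
    (LanF : J → (Site d → Fin d → 𝔸ˣ) → Φ → ℕ → (Site d → Fin d → 𝔸ˣ) → Prop)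
    (SP5base : ∀ a : J, ∀ α₀ α₁ : ℝ, 0 < α₀ → 0 < α₁ → α₀ + α₁ ≤ cP →
      ∀ U₀ U' : Site d → Fin d → 𝔸ˣ, (∀ x κ, U₀ x κ ∈ unitaryUnits 𝔸) → (∀ x κ, U' x κ ∈ unitaryUnits 𝔸) →
      IsPeriodic (p a) U₀ → IsPeriodic (p a) U' → ∀ φ : Φ, Adm a φ U₀ α₀ α₁ →
      InAk L (ι a).k (ι a).η α₀ (ι a).Ω U₀ → InAk L (ι a).k (ι a).η α₀ (ι a).Ω (mulCfg U' U₀) → (∀ m, m ≤ (ι a).k → InAx L m ((ι a).Λs m) U₀ (mulCfg U' U₀)) →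
      (∀ j, j ≤ (ι a).k → ∀ (z : Site d) (μ : Fin d),
        ((∀ x, InBox (tlo L z j) (thi L z j) x → x ∈ (ι a).Ω j) ∨ (∀ x, InBox (tlo L (z + e μ) j) (thi L (z + e μ) j) x → x ∈ (ι a).Ω j)) →
        ‖(avgIter L (mulCfg U' U₀) j z μ : 𝔸) - (avgIter L U₀ j z μ : 𝔸)‖ ≤ α₁) →
      (∀ b ∈ {b : Site d × Fin d | SideTouches ((ι a).Ω 0) b.1 b.2}, ‖((U' b.1 b.2 : 𝔸ˣ) : 𝔸) - 1‖ ≤ α₁) →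
      (∃ (v : Site d → 𝔸ˣ) (lam : Site d → 𝔸), (∀ x, v x ∈ unitaryUnits 𝔸) ∧ (∀ x, x ∉ (ι a).Ω 0 → v x = 1) ∧
        (∀ j, j ≤ 1 → ∀ b ∈ {b : Site d × Fin d | SideTouches ((ι a).Ω j) b.1 b.2}, (v b.1 : 𝔸) = ((gaugeExp lam b.1 : 𝔸ˣ) : 𝔸) ∧
        (v (b.1 + e b.2) : 𝔸) = ((gaugeExp lam (b.1 + e b.2) : 𝔸ˣ) : 𝔸)) ∧
        (∀ j, j ≤ 1 → ∀ b ∈ {b : Site d × Fin d | SideTouches ((ι a).Ω j) b.1 b.2},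
        ‖lam b.1‖ ≤ (8 * B₀' * (5 * (d : ℝ) * L * B₈) * (α₀ + α₁)) ∧ ((L : ℝ) ^ j * (ι a).η) * ‖covDerivFwd (ι a).η U₀ b.2 lam b.1‖ ≤ (8 * B₀' * (5 * (d : ℝ) * L * B₈) * (α₀ + α₁))) ∧
        LanF a U₀ φ 1 (mgauge U₀ v⁻¹ U') ∧ Restr129 L 1 ((ι a).Λs 1) U₀ ((1 : Site d → 𝔸ˣ) * v) ∧ IsPeriodic (p a) v))
    (SP5 : ∀ a : J, ∀ α₀ α₁ : ℝ, 0 < α₀ → 0 < α₁ → α₀ + α₁ ≤ cP →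
      ∀ U₀ U' : Site d → Fin d → 𝔸ˣ, (∀ x κ, U₀ x κ ∈ unitaryUnits 𝔸) → (∀ x κ, U' x κ ∈ unitaryUnits 𝔸) →
      IsPeriodic (p a) U₀ → IsPeriodic (p a) U' → ∀ φ : Φ, Adm a φ U₀ α₀ α₁ →
      InAk L (ι a).k (ι a).η α₀ (ι a).Ω U₀ → InAk L (ι a).k (ι a).η α₀ (ι a).Ω (mulCfg U' U₀) → (∀ m, m ≤ (ι a).k → InAx L m ((ι a).Λs m) U₀ (mulCfg U' U₀)) →
      (∀ j, j ≤ (ι a).k → ∀ (z : Site d) (μ : Fin d),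
        ((∀ x, InBox (tlo L z j) (thi L z j) x → x ∈ (ι a).Ω j) ∨ (∀ x, InBox (tlo L (z + e μ) j) (thi L (z + e μ) j) x → x ∈ (ι a).Ω j)) →
        ‖(avgIter L (mulCfg U' U₀) j z μ : 𝔸) - (avgIter L U₀ j z μ : 𝔸)‖ ≤ α₁) →
      (∀ b ∈ {b : Site d × Fin d | SideTouches ((ι a).Ω 0) b.1 b.2}, ‖((U' b.1 b.2 : 𝔸ˣ) : 𝔸) - 1‖ ≤ α₁) →
      (∀ m, 1 ≤ m → m < (ι a).k → ∀ (u₁ : Site d → 𝔸ˣ) (U₁ : Site d → Fin d → 𝔸ˣ) (A : Site d → Fin d → 𝔸),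
        (∀ x, u₁ x ∈ unitaryUnits 𝔸) → (∀ x, x ∉ (ι a).Ω 0 → u₁ x = 1) → IsPeriodic (p a) u₁ → IsPeriodic (p a) U₁ → IsPeriodic (p a) A →
        mgauge U₀ u₁ U₁ = U' → Restr129 L m ((ι a).Λs m) U₀ u₁ → LanF a U₀ φ m U₁ →
        (∀ j, j ≤ m → ∀ b ∈ {b : Site d × Fin d | SideTouches ((ι a).Ω j) b.1 b.2},
        U₁ b.1 b.2 = cfgExp (ι a).η A b.1 b.2 ∧ IsSelfAdjoint (A b.1 b.2) ∧ ‖A b.1 b.2‖ ≤ (5 * (d : ℝ) * L * B₈ * (α₀ + α₁)) * ((L : ℝ) ^ j * (ι a).η)⁻¹) →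
        ∃ (v : Site d → 𝔸ˣ) (lam : Site d → 𝔸), (∀ x, v x ∈ unitaryUnits 𝔸) ∧ (∀ x, x ∉ (ι a).Ω 0 → v x = 1) ∧
        (∀ j, j ≤ m + 1 → ∀ b ∈ {b : Site d × Fin d | SideTouches ((ι a).Ω j) b.1 b.2}, (v b.1 : 𝔸) = ((gaugeExp lam b.1 : 𝔸ˣ) : 𝔸) ∧
        (v (b.1 + e b.2) : 𝔸) = ((gaugeExp lam (b.1 + e b.2) : 𝔸ˣ) : 𝔸)) ∧
        (∀ j, j ≤ m + 1 → ∀ b ∈ {b : Site d × Fin d | SideTouches ((ι a).Ω j) b.1 b.2},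
        ‖lam b.1‖ ≤ (8 * B₀' * (5 * (d : ℝ) * L * B₈) * (α₀ + α₁)) ∧ ((L : ℝ) ^ j * (ι a).η) * ‖covDerivFwd (ι a).η U₀ b.2 lam b.1‖ ≤ (8 * B₀' * (5 * (d : ℝ) * L * B₈) * (α₀ + α₁))) ∧
        LanF a U₀ φ (m + 1) (mgauge U₀ v⁻¹ U₁) ∧ Restr129 L (m + 1) ((ι a).Λs (m + 1)) U₀ (u₁ * v) ∧ IsPeriodic (p a) v))
    (SH59src : ∀ a : J, ∀ α₀ α₁ : ℝ, 0 < α₀ → 0 < α₁ → α₀ + α₁ ≤ cP →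
      ∀ U₀ U' : Site d → Fin d → 𝔸ˣ, (∀ x κ, U₀ x κ ∈ unitaryUnits 𝔸) → (∀ x κ, U' x κ ∈ unitaryUnits 𝔸) →
      IsPeriodic (p a) U₀ → IsPeriodic (p a) U' → ∀ φ : Φ, Adm a φ U₀ α₀ α₁ →
      InAk L (ι a).k (ι a).η α₀ (ι a).Ω U₀ → InAk L (ι a).k (ι a).η α₀ (ι a).Ω (mulCfg U' U₀) → (∀ m, m ≤ (ι a).k → InAx L m ((ι a).Λs m) U₀ (mulCfg U' U₀)) →
      (∀ j, j ≤ (ι a).k → ∀ (z : Site d) (μ : Fin d),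
        ((∀ x, InBox (tlo L z j) (thi L z j) x → x ∈ (ι a).Ω j) ∨ (∀ x, InBox (tlo L (z + e μ) j) (thi L (z + e μ) j) x → x ∈ (ι a).Ω j)) →
        ‖(avgIter L (mulCfg U' U₀) j z μ : 𝔸) - (avgIter L U₀ j z μ : 𝔸)‖ ≤ α₁) →
      (∀ b ∈ {b : Site d × Fin d | SideTouches ((ι a).Ω 0) b.1 b.2}, ‖((U' b.1 b.2 : 𝔸ˣ) : 𝔸) - 1‖ ≤ α₁) →
      (∀ m, 1 ≤ m → m ≤ (ι a).k → ∀ (u : Site d → 𝔸ˣ) (W : Site d → Fin d → 𝔸ˣ) (A' : Site d → Fin d → 𝔸),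
        (∀ x, u x ∈ unitaryUnits 𝔸) → IsPeriodic (p a) u → IsPeriodic (p a) W → IsPeriodic (p a) A' →
        mgauge U₀ u W = U' → Restr129 L m ((ι a).Λs m) U₀ u → LanF a U₀ φ m W →
        (∀ y τ, IsSelfAdjoint (A' y τ)) →
        (∀ j, j ≤ m → ∀ y τ, SideTouches ((ι a).Ω j) y τ →
        W y τ = cfgExp (ι a).η A' y τ ∧ ‖A' y τ‖ ≤ (2 * (L * (5 * (d : ℝ) * L * B₈ * (α₀ + α₁))) + 8 * (8 * B₀' * (5 * (d : ℝ) * L * B₈) * (α₀ + α₁))) * ((L : ℝ) ^ j * (ι a).η)⁻¹) →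
        (∀ y τ, (∀ j, j ≤ m → ¬ SideTouches ((ι a).Ω j) y τ) → A' y τ = 0) →
        msup L m (ι a).η (-(1 : ℝ)) (fun j (b : Site d × Fin d) => SideTouches ((ι a).Ω j) b.1 b.2) (fun b => A' b.1 b.2)
        ≤ B₀ * (bondNorm L m (ι a).η (-(3 : ℝ)) (ι a).Ω (fun x μ => Jcur (ι a).η U₀ A' μ x)
        + wsup 1 (fun p : {p : ℕ × (Site d × Fin d) // p.1 ≤ m ∧ p.2 ∈ towerBondsP L (ι a).Ω ((ι a).Λs m) p.1} =>
        linCovIter L U₀ (iEta (ι a).η A') p.1.1 p.1.2.1 p.1.2.2)) + γ' * B₀ * (α₀ + α₁) ∧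
        msup L m (ι a).η (-(2 : ℝ)) (fun j (t : Fin d × Fin d × Site d) => SideTouches ((ι a).Ω j) t.2.2 t.2.1)
        (fun t => covDerivFwd (ι a).η U₀ t.1 (fun z => A' z t.2.1) t.2.2)
        ≤ B₀ * (bondNorm L m (ι a).η (-(3 : ℝ)) (ι a).Ω (fun x μ => Jcur (ι a).η U₀ A' μ x)
        + wsup 1 (fun p : {p : ℕ × (Site d × Fin d) // p.1 ≤ m ∧ p.2 ∈ towerBondsP L (ι a).Ω ((ι a).Λs m) p.1} =>
        linCovIter L U₀ (iEta (ι a).η A') p.1.1 p.1.2.1 p.1.2.2)) + γ' * B₀ * (α₀ + α₁)))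
    (SP5u : ∀ a : J, ∀ α₀ α₁ : ℝ, 0 < α₀ → 0 < α₁ → α₀ + α₁ ≤ cP →
      ∀ U₀ U' : Site d → Fin d → 𝔸ˣ, (∀ x κ, U₀ x κ ∈ unitaryUnits 𝔸) → (∀ x κ, U' x κ ∈ unitaryUnits 𝔸) →
      IsPeriodic (p a) U₀ → IsPeriodic (p a) U' → ∀ φ : Φ, Adm a φ U₀ α₀ α₁ →
      InAk L (ι a).k (ι a).η α₀ (ι a).Ω U₀ → InAk L (ι a).k (ι a).η α₀ (ι a).Ω (mulCfg U' U₀) → (∀ m, m ≤ (ι a).k → InAx L m ((ι a).Λs m) U₀ (mulCfg U' U₀)) →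
      (∀ j, j ≤ (ι a).k → ∀ (z : Site d) (μ : Fin d),
        ((∀ x, InBox (tlo L z j) (thi L z j) x → x ∈ (ι a).Ω j) ∨ (∀ x, InBox (tlo L (z + e μ) j) (thi L (z + e μ) j) x → x ∈ (ι a).Ω j)) →
        ‖(avgIter L (mulCfg U' U₀) j z μ : 𝔸) - (avgIter L U₀ j z μ : 𝔸)‖ ≤ α₁) →
      (∀ b ∈ {b : Site d × Fin d | SideTouches ((ι a).Ω 0) b.1 b.2}, ‖((U' b.1 b.2 : 𝔸ˣ) : 𝔸) - 1‖ ≤ α₁) →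
      ∀ u₁ : Site d → 𝔸ˣ, (∀ x, u₁ x ∈ unitaryUnits 𝔸) → (∀ x, x ∉ (ι a).Ω 0 → u₁ x = 1) → IsPeriodic (p a) u₁ → Restr129 L (ι a).k ((ι a).Λs (ι a).k) U₀ u₁ →
      LanF a U₀ φ (ι a).k (mgauge U₀ u₁⁻¹ U') →
      (∃ A₁ : Site d → Fin d → 𝔸, ∀ j, j ≤ (ι a).k → ∀ (x : Site d) (κ : Fin d), SideTouches ((ι a).Ω j) x κ →
        mgauge U₀ u₁⁻¹ U' x κ = cfgExp (ι a).η A₁ x κ ∧ ‖A₁ x κ‖ ≤ (5 * (d : ℝ) * L * B₈ * (α₀ + α₁)) * ((L : ℝ) ^ j * (ι a).η)⁻¹) →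
      ∀ (v w : Site d → 𝔸ˣ) (lam mu : Site d → 𝔸),
      IsPeriodic (p a) v → IsPeriodic (p a) w → IsPeriodic (p a) lam → IsPeriodic (p a) mu →
      (∀ x, ((gaugeExp lam x : 𝔸ˣ) : 𝔸) = ((v x : 𝔸ˣ) : 𝔸) ∧ IsSelfAdjoint (lam x) ∧ ‖lam x‖ < cu) → (∀ x, x ∉ (ι a).Ω 0 → lam x = 0) →
      (∀ j, j ≤ (ι a).k → ∀ b ∈ {b : Site d × Fin d | SideTouches ((ι a).Ω j) b.1 b.2}, ((L : ℝ) ^ j * (ι a).η) * ‖covDerivFwd (ι a).η U₀ b.2 lam b.1‖ < cu) →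
      (∀ x, ((gaugeExp mu x : 𝔸ˣ) : 𝔸) = ((w x : 𝔸ˣ) : 𝔸) ∧ IsSelfAdjoint (mu x) ∧ ‖mu x‖ < cu) → (∀ x, x ∉ (ι a).Ω 0 → mu x = 0) →
      (∀ j, j ≤ (ι a).k → ∀ b ∈ {b : Site d × Fin d | SideTouches ((ι a).Ω j) b.1 b.2}, ((L : ℝ) ^ j * (ι a).η) * ‖covDerivFwd (ι a).η U₀ b.2 mu b.1‖ < cu) →
      LanF a U₀ φ (ι a).k (mgauge U₀ v⁻¹ (mgauge U₀ u₁⁻¹ U')) → Restr129 L (ι a).k ((ι a).Λs (ι a).k) U₀ (u₁ * v) →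
      LanF a U₀ φ (ι a).k (mgauge U₀ w⁻¹ (mgauge U₀ u₁⁻¹ U')) → Restr129 L (ι a).k ((ι a).Λs (ι a).k) U₀ (u₁ * w) →
      ∀ x, v x = w x) :
    ∃ c₁ : ℝ, 0 < c₁ ∧ ∀ a : J,
      -- the tower law at EVERY truncation of the member `ι a` ((1.5)–(1.6) p. 77; `IdxB8Sub.tower_all` at the law members)
      (∀ m, m ≤ (ι a).k → ∀ j, j ≤ m → ∀ y ∈ (ι a).Λs m j, ∀ x, InBox (tlo L y j) (thi L y j) x → x ∈ (ι a).Ω j) →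
      -- the domains `Ω_j`, `j ≤ k`, are `(p a)`-periodic (the periodic (1.5)-index's law; print's «Ω_j ⊂ T_η», p. 77)
      (∀ j, j ≤ (ι a).k → IsPeriodic (p a) (fun x : Site d => x ∈ (ι a).Ω j)) →
      ∀ α₀ α₁ : ℝ, 0 < α₀ → 0 < α₁ → α₀ + α₁ ≤ c₁ →
      ∀ (U₀ : (zdGF3HP₂Per 𝔸 L β len (ι a) (p a)).Cfg) (Q : (zdGF3HP₂Per 𝔸 L β len (ι a) (p a)).Pert) (φ : Φ), Adm a φ U₀.1 α₀ α₁ →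
        (zdGF3HP₂Per 𝔸 L β len (ι a) (p a)).InA α₀ U₀ → (zdGF3HP₂Per 𝔸 L β len (ι a) (p a)).InAAx α₀ U₀ Q → (zdGF3HP₂Per 𝔸 L β len (ι a) (p a)).avgClose166 α₁ U₀ Q →
        ∃ u : (zdGF3HP₂Per 𝔸 L β len (ι a) (p a)).GT, (zdGF3HP₂Per 𝔸 L β len (ι a) (p a)).Restricted U₀ u ∧
          ((zdGF3HP₂Per 𝔸 L β len (ι a) (p a)).C137 α₁ U₀ ((zdGF3HP₂Per 𝔸 L β len (ι a) (p a)).act Q u) ∧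
            LanF a U₀.1 φ (ι a).k ((zdGF3HP₂Per 𝔸 L β len (ι a) (p a)).act Q u).2.1 ∧
            (zdGF3HP₂Per 𝔸 L β len (ι a) (p a)).C162 (5 * (d : ℝ) * L * B₈) (α₀ + α₁) U₀ ((zdGF3HP₂Per 𝔸 L β len (ι a) (p a)).act Q u)) ∧
          ∀ u' : (zdGF3HP₂Per 𝔸 L β len (ι a) (p a)).GT, (zdGF3HP₂Per 𝔸 L β len (ι a) (p a)).Restricted U₀ u' →
            LanF a U₀.1 φ (ι a).k ((zdGF3HP₂Per 𝔸 L β len (ι a) (p a)).act Q u').2.1 →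
            (zdGF3HP₂Per 𝔸 L β len (ι a) (p a)).C162 (5 * (d : ℝ) * L * B₈) (α₀ + α₁) U₀ ((zdGF3HP₂Per 𝔸 L β len (ι a) (p a)).act Q u') → u' = u := by
  have hL1 : 1 ≤ L := le_trans (by norm_num) hL
  have hd1 : 1 ≤ d := le_trans (by norm_num) hd2
  have hL' : (1 : ℝ) ≤ L := by exact_mod_cast hL1
  obtain ⟨c₁, hc₁, H⟩ := thm4Body_concrete_uniform_lanE_γ'_per (𝔸 := 𝔸) hd2 hL hB₀ hB₀' hcu hcP (Φ := Φ) hγ' hB₈ hB₀8 hB hγB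
  obtain ⟨cw', hcw', hw'⟩ := thm4_windows_extra (d := d) hL1
  obtain ⟨cγ, hcγ, hwγ⟩ := thm4_windows_γ hd1 hL1 hB₈ hB₀' hB
  refine ⟨min c₁ (min cγ cw'), lt_min hc₁ (lt_min hcγ hcw'), ?_⟩
  intro a htw hΩp α₀ α₁ hα₀ hα₁ hs U₀ Q φ hφ hInA hInAAx h166
  have hs₁ : α₀ + α₁ ≤ c₁ := hs.trans (min_le_left _ _)
  have hsγ : α₀ + α₁ ≤ cγ := hs.trans ((min_le_right _ _).trans (min_le_left _ _))
  have hsw' : α₀ + α₁ ≤ cw' := hs.trans ((min_le_right _ _).trans (min_le_right _ _))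
  obtain ⟨hQ1, h34, hAx⟩ := hInAAx
  obtain ⟨h135, h66⟩ := h166
  -- `InAAx`'s first conjunct pins the pair's background to `U₀` (as periodic carriers)
  have hQU : Q.1 = U₀ := Subtype.ext (congrArg Subtype.val hQ1 :)
  subst hQU
  -- dag-n05-w1's periodic body at the member's letters, the underlying fields, the carriers' periodicity and `hΩp`
  obtain ⟨u, hu, huS, hper, h129, hLan, hleaf, huniq⟩ := H (Adm a) (LanF a) (ι a).η (ι a).hη (ι a).k (p a) (ι a).Ω (ι a).hΩ hΩp (ι a).Λs
    (fun m j => towerBondsP L (ι a).Ω ((ι a).Λs m) j) (B8TowerBondsPrinted.ZdIdx.towerBondsP_laws (ι a)).1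
    (B8TowerBondsPrinted.ZdIdx.towerBondsP_laws (ι a)).2 (ι a).htower (ι a).hpart htw
    (SP5base a) (SP5 a) (SH59src a) (SP5u a) α₀ α₁ hα₀ hα₁ hs₁ Q.1.1 Q.2.1 Q.1.2.1 Q.2.2.1 Q.1.2.2 Q.2.2.2 φ hφ hInA h34 hAx h135 h66
  -- windows for the γ′ (1.42) lemma (at the enlarged constant `B₈`; [3] Prop. 4 at `(L²α₀, L·α₂)`)
  obtain ⟨g3, g4, g16, gsmall, gc₃, -, -⟩ :=
    hwγ α₀ α₁ hα₀ hα₁ hsγ (5 * (d : ℝ) * L * B₈ * (α₀ + α₁)) (8 * B₀' * (5 * (d : ℝ) * L * B₈) * (α₀ + α₁)) rfl rfl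
  obtain ⟨w19, -⟩ := hw' α₀ α₁ hα₀ hα₁ hsw'
  have hcs0 : 0 ≤ 5 * (d : ℝ) * L * B₈ * (α₀ + α₁) := by positivity
  have hKS0 : 0 ≤ 2 * (L * (5 * (d : ℝ) * L * B₈ * (α₀ + α₁))) + 8 * (8 * B₀' * (5 * (d : ℝ) * L * B₈) * (α₀ + α₁)) := by
    positivity
  have hcK : 5 * (d : ℝ) * L * B₈ * (α₀ + α₁) ≤
      2 * (L * (5 * (d : ℝ) * L * B₈ * (α₀ + α₁))) + 8 * (8 * B₀' * (5 * (d : ℝ) * L * B₈) * (α₀ + α₁)) := by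
    have h₁ : (1 : ℝ) * (5 * (d : ℝ) * L * B₈ * (α₀ + α₁)) ≤ L * (5 * (d : ℝ) * L * B₈ * (α₀ + α₁)) :=
      mul_le_mul_of_nonneg_right hL' hcs0
    have h₂ : 0 ≤ 8 * (8 * B₀' * (5 * (d : ℝ) * L * B₈) * (α₀ + α₁)) := by positivity
    linarith
  have hc16 : 16 * (5 * (d : ℝ) * L * B₈ * (α₀ + α₁)) ≤ 1 := by
    have hLα : 2 * (L * (5 * (d : ℝ) * L * B₈ * (α₀ + α₁))) + 8 * (8 * B₀' * (5 * (d : ℝ) * L * B₈) * (α₀ + α₁)) ≤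
        (L : ℝ) * (2 * (L * (5 * (d : ℝ) * L * B₈ * (α₀ + α₁))) + 8 * (8 * B₀' * (5 * (d : ℝ) * L * B₈) * (α₀ + α₁))) := by
      have := mul_le_mul_of_nonneg_right hL' hKS0
      linarith
    linarith
  -- the gauge-fixed field and its CANONICAL masked exponent
  have hW : mgauge Q.1.1 u (mgauge Q.1.1 u⁻¹ Q.2.1) = Q.2.1 := mgauge_mgauge_inv Q.1.1 Q.2.1 u
  have hWu : ∀ x κ, mgauge Q.1.1 u⁻¹ Q.2.1 x κ ∈ unitaryUnits 𝔸 := mem_unitaryUnits_of_mgauge_eq Q.1.2.1 Q.2.2.1 hu hW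
  have hWA : ∀ j, j ≤ (ι a).k → ∀ y τ, SideTouches ((ι a).Ω j) y τ →
      mgauge Q.1.1 u⁻¹ Q.2.1 y τ = cfgExp (ι a).η (logCfg (ι a).η (mgauge Q.1.1 u⁻¹ Q.2.1)) y τ ∧
        ‖logCfg (ι a).η (mgauge Q.1.1 u⁻¹ Q.2.1) y τ‖ ≤ (5 * (d : ℝ) * L * B₈ * (α₀ + α₁)) * ((L : ℝ) ^ j * (ι a).η)⁻¹ :=
    fun j hj y τ h => ⟨(hleaf j hj (y, τ) h).1, (hleaf j hj (y, τ) h).2.2⟩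
  obtain ⟨hA'sa, hA'eq, hA'zero⟩ := mlogCfg_spec (ι a).hη hL1 (ι a).k Q.1.1 hWu hcs0 hc16 (ι a).Ω hWA
  set A' := mlogCfg (ι a).k (ι a).η (ι a).Ω (mgauge Q.1.1 u⁻¹ Q.2.1) with hA'_def
  have hA'bd : ∀ j, j ≤ (ι a).k → ∀ y τ, SideTouches ((ι a).Ω j) y τ →
      mgauge Q.1.1 u⁻¹ Q.2.1 y τ = cfgExp (ι a).η A' y τ ∧
        ‖A' y τ‖ ≤ (2 * (L * (5 * (d : ℝ) * L * B₈ * (α₀ + α₁))) + 8 * (8 * B₀' * (5 * (d : ℝ) * L * B₈) * (α₀ + α₁))) *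
          ((L : ℝ) ^ j * (ι a).η)⁻¹ := by
    intro j hj y τ h
    obtain ⟨hAA, hWexp⟩ := hA'eq j hj y τ h
    refine ⟨hWexp, ?_⟩
    rw [hAA]
    have hη0 : 0 ≤ (ι a).η := (ι a).hη.le
    exact ((hWA j hj y τ h).2).trans (mul_le_mul_of_nonneg_right hcK (by positivity))
  have h137 := B8Eq142KLevelLocalGammaPrime.H42_of_inAx_γ' hd2 (ι a).hη hL (ι a).k Q.1.2.1 hα₀ hα₁ hKS0 g3 g4 g16 gsmall gc₃ w19 (ι a).Ω
    (ι a).hΩ (ι a).Λs (fun m j => towerBondsP L (ι a).Ω ((ι a).Λs m) j) (B8TowerBondsPrinted.ZdIdx.towerBondsP_laws (ι a)).1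
    (B8TowerBondsPrinted.ZdIdx.towerBondsP_laws (ι a)).2 hInA h34 hAx h135 (fun m W => LanF a Q.1.1 φ m W) (ι a).k (ι a).hk le_rfl
    (htw (ι a).k le_rfl) u (mgauge Q.1.1 u⁻¹ Q.2.1) A' hu hW h129 (hLan (ι a).hk) hA'sa hA'bd hA'zero
  -- the witness IN THE PERIODIC GAUGE GROUP: periodic because T4b says so
  refine ⟨⟨u, ⟨hu, huS⟩, hper⟩, h129, ⟨h137, hLan (ι a).hk, ?_⟩, ?_⟩
  · intro j hj b hb
    exact hleaf j hj b hb
  · -- uniqueness among the member's (periodic, restricted) competitors = T4b's uniqueness among periodic competitors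
    intro u' hR' hLan' h162'
    apply Subtype.ext
    refine huniq u'.1 u'.2.1.1 u'.2.1.2 u'.2.2 hR' hLan' ⟨logCfg (ι a).η (mgauge Q.1.1 u'.1⁻¹ Q.2.1), fun j hj x κ h => ?_⟩ (ι a).hk
    exact ⟨(h162' j hj (x, κ) h).1, (h162' j hj (x, κ) h).2.2⟩

/-- ★★ **THE SAME CORE, SINGLE-FAMILY EDITION `∀ (i : ZdIdx d L) (P : ℕ)`** — `thm4Core_zdGF3HP₂Per_map_lanE_γ'` at `J := ZdIdx d L × ℕ`, `ι := Prod.fst`,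
`p := Prod.snd`: admissibility `Adm i`, gauge predicate `LanF i`, the four GUARDED sockets indexed by the member `i` AND the period `P` (each asked at
`P`-periodic arguments only), ONE threshold, and at every member `i`, every period `P` with `P`-periodic `Ω_j` (`j ≤ k`) and the tower law at every
truncation: the Theorem-4 conclusion on `zdGF3HP₂Per 𝔸 L β len i P` (restricted periodic `u`, (1.37), `LanF i`, (1.62)-shape, uniqueness in `GT_per`) —
dag-n05-d's `thm4Core_zdGF3HP_lanE_γ'` on the periodic member.
[cite: Balaban1985RegularSpaces, Thm 4 p.88, Thm 8 (1.146) p.101, (1.29) p.81, (1.37)–(1.38) p.82, (1.62) p.87, Prop. 5 p.94, pp.94–95, p.77 («Ω_j ⊂ T_η»); Balaban1985BackgroundPropagators, Thm 3.3 p.398] -/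
theorem thm4Core_zdGF3HP₂Per_lanE_γ' (hd2 : 2 ≤ d) {L : ℕ} (hL : 2 ≤ L) {β : ℝ} {len : Site d → ℝ} {B₀ B₀' cu cP : ℝ} (hB₀ : 0 < B₀)
    (hB₀' : 0 < B₀') (hcu : 0 < cu) (hcP : 0 < cP)
    {Φ : Type*} {γ' B₈ : ℝ} (hγ' : 0 ≤ γ') (hB₈ : 0 < B₈) (hB₀8 : B₀ ≤ B₈) (hB : 2 ≤ 5 * (d : ℝ) * L * B₈)
    (hγB : 5 * (d : ℝ) * L * B₀ + 2 * (γ' * B₀) ≤ 5 * (d : ℝ) * L * B₈)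
    (Adm : ZdIdx d L → Φ → (Site d → Fin d → 𝔸ˣ) → ℝ → ℝ → Prop)
    (LanF : ZdIdx d L → (Site d → Fin d → 𝔸ˣ) → Φ → ℕ → (Site d → Fin d → 𝔸ˣ) → Prop)
    (SP5base : ∀ (i : ZdIdx d L) (P : ℕ), ∀ α₀ α₁ : ℝ, 0 < α₀ → 0 < α₁ → α₀ + α₁ ≤ cP →
      ∀ U₀ U' : Site d → Fin d → 𝔸ˣ, (∀ x κ, U₀ x κ ∈ unitaryUnits 𝔸) → (∀ x κ, U' x κ ∈ unitaryUnits 𝔸) →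
      IsPeriodic P U₀ → IsPeriodic P U' → ∀ φ : Φ, Adm i φ U₀ α₀ α₁ →
      InAk L i.k i.η α₀ i.Ω U₀ → InAk L i.k i.η α₀ i.Ω (mulCfg U' U₀) → (∀ m, m ≤ i.k → InAx L m (i.Λs m) U₀ (mulCfg U' U₀)) →
      (∀ j, j ≤ i.k → ∀ (z : Site d) (μ : Fin d),
        ((∀ x, InBox (tlo L z j) (thi L z j) x → x ∈ i.Ω j) ∨ (∀ x, InBox (tlo L (z + e μ) j) (thi L (z + e μ) j) x → x ∈ i.Ω j)) →
        ‖(avgIter L (mulCfg U' U₀) j z μ : 𝔸) - (avgIter L U₀ j z μ : 𝔸)‖ ≤ α₁) →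
      (∀ b ∈ {b : Site d × Fin d | SideTouches (i.Ω 0) b.1 b.2}, ‖((U' b.1 b.2 : 𝔸ˣ) : 𝔸) - 1‖ ≤ α₁) →
      (∃ (v : Site d → 𝔸ˣ) (lam : Site d → 𝔸), (∀ x, v x ∈ unitaryUnits 𝔸) ∧ (∀ x, x ∉ i.Ω 0 → v x = 1) ∧
        (∀ j, j ≤ 1 → ∀ b ∈ {b : Site d × Fin d | SideTouches (i.Ω j) b.1 b.2}, (v b.1 : 𝔸) = ((gaugeExp lam b.1 : 𝔸ˣ) : 𝔸) ∧
        (v (b.1 + e b.2) : 𝔸) = ((gaugeExp lam (b.1 + e b.2) : 𝔸ˣ) : 𝔸)) ∧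
        (∀ j, j ≤ 1 → ∀ b ∈ {b : Site d × Fin d | SideTouches (i.Ω j) b.1 b.2},
        ‖lam b.1‖ ≤ (8 * B₀' * (5 * (d : ℝ) * L * B₈) * (α₀ + α₁)) ∧ ((L : ℝ) ^ j * i.η) * ‖covDerivFwd i.η U₀ b.2 lam b.1‖ ≤ (8 * B₀' * (5 * (d : ℝ) * L * B₈) * (α₀ + α₁))) ∧
        LanF i U₀ φ 1 (mgauge U₀ v⁻¹ U') ∧ Restr129 L 1 (i.Λs 1) U₀ ((1 : Site d → 𝔸ˣ) * v) ∧ IsPeriodic P v))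
    (SP5 : ∀ (i : ZdIdx d L) (P : ℕ), ∀ α₀ α₁ : ℝ, 0 < α₀ → 0 < α₁ → α₀ + α₁ ≤ cP →
      ∀ U₀ U' : Site d → Fin d → 𝔸ˣ, (∀ x κ, U₀ x κ ∈ unitaryUnits 𝔸) → (∀ x κ, U' x κ ∈ unitaryUnits 𝔸) →
      IsPeriodic P U₀ → IsPeriodic P U' → ∀ φ : Φ, Adm i φ U₀ α₀ α₁ →
      InAk L i.k i.η α₀ i.Ω U₀ → InAk L i.k i.η α₀ i.Ω (mulCfg U' U₀) → (∀ m, m ≤ i.k → InAx L m (i.Λs m) U₀ (mulCfg U' U₀)) →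
      (∀ j, j ≤ i.k → ∀ (z : Site d) (μ : Fin d),
        ((∀ x, InBox (tlo L z j) (thi L z j) x → x ∈ i.Ω j) ∨ (∀ x, InBox (tlo L (z + e μ) j) (thi L (z + e μ) j) x → x ∈ i.Ω j)) →
        ‖(avgIter L (mulCfg U' U₀) j z μ : 𝔸) - (avgIter L U₀ j z μ : 𝔸)‖ ≤ α₁) →
      (∀ b ∈ {b : Site d × Fin d | SideTouches (i.Ω 0) b.1 b.2}, ‖((U' b.1 b.2 : 𝔸ˣ) : 𝔸) - 1‖ ≤ α₁) →
      (∀ m, 1 ≤ m → m < i.k → ∀ (u₁ : Site d → 𝔸ˣ) (U₁ : Site d → Fin d → 𝔸ˣ) (A : Site d → Fin d → 𝔸),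
        (∀ x, u₁ x ∈ unitaryUnits 𝔸) → (∀ x, x ∉ i.Ω 0 → u₁ x = 1) → IsPeriodic P u₁ → IsPeriodic P U₁ → IsPeriodic P A →
        mgauge U₀ u₁ U₁ = U' → Restr129 L m (i.Λs m) U₀ u₁ → LanF i U₀ φ m U₁ →
        (∀ j, j ≤ m → ∀ b ∈ {b : Site d × Fin d | SideTouches (i.Ω j) b.1 b.2},
        U₁ b.1 b.2 = cfgExp i.η A b.1 b.2 ∧ IsSelfAdjoint (A b.1 b.2) ∧ ‖A b.1 b.2‖ ≤ (5 * (d : ℝ) * L * B₈ * (α₀ + α₁)) * ((L : ℝ) ^ j * i.η)⁻¹) →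
        ∃ (v : Site d → 𝔸ˣ) (lam : Site d → 𝔸), (∀ x, v x ∈ unitaryUnits 𝔸) ∧ (∀ x, x ∉ i.Ω 0 → v x = 1) ∧
        (∀ j, j ≤ m + 1 → ∀ b ∈ {b : Site d × Fin d | SideTouches (i.Ω j) b.1 b.2}, (v b.1 : 𝔸) = ((gaugeExp lam b.1 : 𝔸ˣ) : 𝔸) ∧
        (v (b.1 + e b.2) : 𝔸) = ((gaugeExp lam (b.1 + e b.2) : 𝔸ˣ) : 𝔸)) ∧
        (∀ j, j ≤ m + 1 → ∀ b ∈ {b : Site d × Fin d | SideTouches (i.Ω j) b.1 b.2},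
        ‖lam b.1‖ ≤ (8 * B₀' * (5 * (d : ℝ) * L * B₈) * (α₀ + α₁)) ∧ ((L : ℝ) ^ j * i.η) * ‖covDerivFwd i.η U₀ b.2 lam b.1‖ ≤ (8 * B₀' * (5 * (d : ℝ) * L * B₈) * (α₀ + α₁))) ∧
        LanF i U₀ φ (m + 1) (mgauge U₀ v⁻¹ U₁) ∧ Restr129 L (m + 1) (i.Λs (m + 1)) U₀ (u₁ * v) ∧ IsPeriodic P v))
    (SH59src : ∀ (i : ZdIdx d L) (P : ℕ), ∀ α₀ α₁ : ℝ, 0 < α₀ → 0 < α₁ → α₀ + α₁ ≤ cP →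
      ∀ U₀ U' : Site d → Fin d → 𝔸ˣ, (∀ x κ, U₀ x κ ∈ unitaryUnits 𝔸) → (∀ x κ, U' x κ ∈ unitaryUnits 𝔸) →
      IsPeriodic P U₀ → IsPeriodic P U' → ∀ φ : Φ, Adm i φ U₀ α₀ α₁ →
      InAk L i.k i.η α₀ i.Ω U₀ → InAk L i.k i.η α₀ i.Ω (mulCfg U' U₀) → (∀ m, m ≤ i.k → InAx L m (i.Λs m) U₀ (mulCfg U' U₀)) →
      (∀ j, j ≤ i.k → ∀ (z : Site d) (μ : Fin d),
        ((∀ x, InBox (tlo L z j) (thi L z j) x → x ∈ i.Ω j) ∨ (∀ x, InBox (tlo L (z + e μ) j) (thi L (z + e μ) j) x → x ∈ i.Ω j)) →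
        ‖(avgIter L (mulCfg U' U₀) j z μ : 𝔸) - (avgIter L U₀ j z μ : 𝔸)‖ ≤ α₁) →
      (∀ b ∈ {b : Site d × Fin d | SideTouches (i.Ω 0) b.1 b.2}, ‖((U' b.1 b.2 : 𝔸ˣ) : 𝔸) - 1‖ ≤ α₁) →
      (∀ m, 1 ≤ m → m ≤ i.k → ∀ (u : Site d → 𝔸ˣ) (W : Site d → Fin d → 𝔸ˣ) (A' : Site d → Fin d → 𝔸),
        (∀ x, u x ∈ unitaryUnits 𝔸) → IsPeriodic P u → IsPeriodic P W → IsPeriodic P A' →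
        mgauge U₀ u W = U' → Restr129 L m (i.Λs m) U₀ u → LanF i U₀ φ m W →
        (∀ y τ, IsSelfAdjoint (A' y τ)) →
        (∀ j, j ≤ m → ∀ y τ, SideTouches (i.Ω j) y τ →
        W y τ = cfgExp i.η A' y τ ∧ ‖A' y τ‖ ≤ (2 * (L * (5 * (d : ℝ) * L * B₈ * (α₀ + α₁))) + 8 * (8 * B₀' * (5 * (d : ℝ) * L * B₈) * (α₀ + α₁))) * ((L : ℝ) ^ j * i.η)⁻¹) →
        (∀ y τ, (∀ j, j ≤ m → ¬ SideTouches (i.Ω j) y τ) → A' y τ = 0) →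
        msup L m i.η (-(1 : ℝ)) (fun j (b : Site d × Fin d) => SideTouches (i.Ω j) b.1 b.2) (fun b => A' b.1 b.2)
        ≤ B₀ * (bondNorm L m i.η (-(3 : ℝ)) i.Ω (fun x μ => Jcur i.η U₀ A' μ x)
        + wsup 1 (fun p : {p : ℕ × (Site d × Fin d) // p.1 ≤ m ∧ p.2 ∈ towerBondsP L i.Ω (i.Λs m) p.1} =>
        linCovIter L U₀ (iEta i.η A') p.1.1 p.1.2.1 p.1.2.2)) + γ' * B₀ * (α₀ + α₁) ∧
        msup L m i.η (-(2 : ℝ)) (fun j (t : Fin d × Fin d × Site d) => SideTouches (i.Ω j) t.2.2 t.2.1)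
        (fun t => covDerivFwd i.η U₀ t.1 (fun z => A' z t.2.1) t.2.2)
        ≤ B₀ * (bondNorm L m i.η (-(3 : ℝ)) i.Ω (fun x μ => Jcur i.η U₀ A' μ x)
        + wsup 1 (fun p : {p : ℕ × (Site d × Fin d) // p.1 ≤ m ∧ p.2 ∈ towerBondsP L i.Ω (i.Λs m) p.1} =>
        linCovIter L U₀ (iEta i.η A') p.1.1 p.1.2.1 p.1.2.2)) + γ' * B₀ * (α₀ + α₁)))
    (SP5u : ∀ (i : ZdIdx d L) (P : ℕ), ∀ α₀ α₁ : ℝ, 0 < α₀ → 0 < α₁ → α₀ + α₁ ≤ cP →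
      ∀ U₀ U' : Site d → Fin d → 𝔸ˣ, (∀ x κ, U₀ x κ ∈ unitaryUnits 𝔸) → (∀ x κ, U' x κ ∈ unitaryUnits 𝔸) →
      IsPeriodic P U₀ → IsPeriodic P U' → ∀ φ : Φ, Adm i φ U₀ α₀ α₁ →
      InAk L i.k i.η α₀ i.Ω U₀ → InAk L i.k i.η α₀ i.Ω (mulCfg U' U₀) → (∀ m, m ≤ i.k → InAx L m (i.Λs m) U₀ (mulCfg U' U₀)) →
      (∀ j, j ≤ i.k → ∀ (z : Site d) (μ : Fin d),
        ((∀ x, InBox (tlo L z j) (thi L z j) x → x ∈ i.Ω j) ∨ (∀ x, InBox (tlo L (z + e μ) j) (thi L (z + e μ) j) x → x ∈ i.Ω j)) →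
        ‖(avgIter L (mulCfg U' U₀) j z μ : 𝔸) - (avgIter L U₀ j z μ : 𝔸)‖ ≤ α₁) →
      (∀ b ∈ {b : Site d × Fin d | SideTouches (i.Ω 0) b.1 b.2}, ‖((U' b.1 b.2 : 𝔸ˣ) : 𝔸) - 1‖ ≤ α₁) →
      ∀ u₁ : Site d → 𝔸ˣ, (∀ x, u₁ x ∈ unitaryUnits 𝔸) → (∀ x, x ∉ i.Ω 0 → u₁ x = 1) → IsPeriodic P u₁ → Restr129 L i.k (i.Λs i.k) U₀ u₁ →
      LanF i U₀ φ i.k (mgauge U₀ u₁⁻¹ U') →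
      (∃ A₁ : Site d → Fin d → 𝔸, ∀ j, j ≤ i.k → ∀ (x : Site d) (κ : Fin d), SideTouches (i.Ω j) x κ →
        mgauge U₀ u₁⁻¹ U' x κ = cfgExp i.η A₁ x κ ∧ ‖A₁ x κ‖ ≤ (5 * (d : ℝ) * L * B₈ * (α₀ + α₁)) * ((L : ℝ) ^ j * i.η)⁻¹) →
      ∀ (v w : Site d → 𝔸ˣ) (lam mu : Site d → 𝔸),
      IsPeriodic P v → IsPeriodic P w → IsPeriodic P lam → IsPeriodic P mu →
      (∀ x, ((gaugeExp lam x : 𝔸ˣ) : 𝔸) = ((v x : 𝔸ˣ) : 𝔸) ∧ IsSelfAdjoint (lam x) ∧ ‖lam x‖ < cu) → (∀ x, x ∉ i.Ω 0 → lam x = 0) →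
      (∀ j, j ≤ i.k → ∀ b ∈ {b : Site d × Fin d | SideTouches (i.Ω j) b.1 b.2}, ((L : ℝ) ^ j * i.η) * ‖covDerivFwd i.η U₀ b.2 lam b.1‖ < cu) →
      (∀ x, ((gaugeExp mu x : 𝔸ˣ) : 𝔸) = ((w x : 𝔸ˣ) : 𝔸) ∧ IsSelfAdjoint (mu x) ∧ ‖mu x‖ < cu) → (∀ x, x ∉ i.Ω 0 → mu x = 0) →
      (∀ j, j ≤ i.k → ∀ b ∈ {b : Site d × Fin d | SideTouches (i.Ω j) b.1 b.2}, ((L : ℝ) ^ j * i.η) * ‖covDerivFwd i.η U₀ b.2 mu b.1‖ < cu) →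
      LanF i U₀ φ i.k (mgauge U₀ v⁻¹ (mgauge U₀ u₁⁻¹ U')) → Restr129 L i.k (i.Λs i.k) U₀ (u₁ * v) →
      LanF i U₀ φ i.k (mgauge U₀ w⁻¹ (mgauge U₀ u₁⁻¹ U')) → Restr129 L i.k (i.Λs i.k) U₀ (u₁ * w) →
      ∀ x, v x = w x) :
    ∃ c₁ : ℝ, 0 < c₁ ∧ ∀ (i : ZdIdx d L) (P : ℕ),
      -- the tower law at EVERY truncation of the member ((1.5)–(1.6) p. 77; `IdxB8Sub.tower_all` at the law members)
      (∀ m, m ≤ i.k → ∀ j, j ≤ m → ∀ y ∈ i.Λs m j, ∀ x, InBox (tlo L y j) (thi L y j) x → x ∈ i.Ω j) →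
      -- the domains `Ω_j`, `j ≤ k`, are `P`-periodic (print's «Ω_j ⊂ T_η», p. 77)
      (∀ j, j ≤ i.k → IsPeriodic P (fun x : Site d => x ∈ i.Ω j)) →
      ∀ α₀ α₁ : ℝ, 0 < α₀ → 0 < α₁ → α₀ + α₁ ≤ c₁ →
      ∀ (U₀ : (zdGF3HP₂Per 𝔸 L β len i P).Cfg) (Q : (zdGF3HP₂Per 𝔸 L β len i P).Pert) (φ : Φ), Adm i φ U₀.1 α₀ α₁ →
        (zdGF3HP₂Per 𝔸 L β len i P).InA α₀ U₀ → (zdGF3HP₂Per 𝔸 L β len i P).InAAx α₀ U₀ Q → (zdGF3HP₂Per 𝔸 L β len i P).avgClose166 α₁ U₀ Q →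
        ∃ u : (zdGF3HP₂Per 𝔸 L β len i P).GT, (zdGF3HP₂Per 𝔸 L β len i P).Restricted U₀ u ∧
          ((zdGF3HP₂Per 𝔸 L β len i P).C137 α₁ U₀ ((zdGF3HP₂Per 𝔸 L β len i P).act Q u) ∧
            LanF i U₀.1 φ i.k ((zdGF3HP₂Per 𝔸 L β len i P).act Q u).2.1 ∧
            (zdGF3HP₂Per 𝔸 L β len i P).C162 (5 * (d : ℝ) * L * B₈) (α₀ + α₁) U₀ ((zdGF3HP₂Per 𝔸 L β len i P).act Q u)) ∧
          ∀ u' : (zdGF3HP₂Per 𝔸 L β len i P).GT, (zdGF3HP₂Per 𝔸 L β len i P).Restricted U₀ u' →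
            LanF i U₀.1 φ i.k ((zdGF3HP₂Per 𝔸 L β len i P).act Q u').2.1 →
            (zdGF3HP₂Per 𝔸 L β len i P).C162 (5 * (d : ℝ) * L * B₈) (α₀ + α₁) U₀ ((zdGF3HP₂Per 𝔸 L β len i P).act Q u') → u' = u := by
  obtain ⟨c₁, hc₁, H⟩ := thm4Core_zdGF3HP₂Per_map_lanE_γ' (𝔸 := 𝔸) (β := β) (len := len) hd2 hL hB₀ hB₀' hcu hcP (Φ := Φ) hγ' hB₈ hB₀8 hB
    hγB (J := ZdIdx d L × ℕ) Prod.fst Prod.snd (fun q => Adm q.1) (fun q => LanF q.1)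
    (fun q => SP5base q.1 q.2) (fun q => SP5 q.1 q.2) (fun q => SH59src q.1 q.2) (fun q => SP5u q.1 q.2)
  exact ⟨c₁, hc₁, fun i P => H (i, P)⟩

end Core

#print axioms thm4Core_zdGF3HP₂Per_map_lanE_γ'
#print axioms thm4Core_zdGF3HP₂Per_lanE_γ'

end Literature.MathematicalPhysics.QuantumFieldTheory.Balaban1983to89.B8Thm4CoreZdGF3HP2PerLanEGamma

end
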